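import Summits.ABC.ABC.Theorems.TwistAmplificationSharpModerateLawAbcOfDeepRegimeLawSummit
import Summits.ABC.ABC.Theorems.TwistAmplificationSharpModerateLawThickReduction

/-!
# Crux `TwistAmplification.SharpModerateLaw` (stmt-ABC-1975), line `deep-moduli-cusp-dispersion`:
the unified named core of the two thick stubs implies the summit

Lead `prover-line-stmt-ABC-1975-c2-0`, 2026-08-16 (cycle 2).  `ThickMissingTw` (`…CuspDispersionThickDefs.lean`) is the
conductor-free class sum that is EQUIVALENT up to `X^ε` to the conjunction of the conclusions of the line's two open
thick stubs (`lawOn_thickTw_of_thickMissing`, `thickMissingTw_of_lawOn_thickTw`, `…ThickReduction.lean`).  Composing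
with the summit calibration `abc_of_lawOn_deepRegimeTw` (`…AbcOfDeepRegimeLawSummit.lean`): the named core alone
implies `ABC`, and so does the twist-aware thick law `LawOn ThickTw`.  Registered sub-goal `abc_of_thickMissingTw`.
-/

noncomputable section

-- `Summit.<Summit>.<Problem>` is the mandated summit-side namespace (CONVENTIONS §2); for the
-- single-conjunct summit `ABC` the two coincide, so the duplicate `ABC.ABC` is deliberate.
set_option linter.dupNamespace false

namespace Summit.ABC.ABC.Theorems.SharpModerateLaw.CuspDispersion

/-- **The named open core implies the summit**: `ThickMissingTw → ABC` (through `LawOn DeepRegimeTw`).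
Registered sub-goal `abc_of_thickMissingTw` of stmt-ABC-1975. -/
theorem abc_of_thickMissingTw : ThickMissingTw → _root_.ABC :=
  fun h => abc_of_lawOn_deepRegimeTw (lawOn_deepRegimeTw_of_thickMissing h)

/-- The twist-aware thick law `LawOn ThickTw` (= the conclusions of stubs 3 and 4 together) implies the summit. -/
theorem abc_of_lawOn_thickTw : LawOn ThickTw → _root_.ABC :=
  fun h => abc_of_lawOn_deepRegimeTw (lawOn_deepRegimeTw_of_lawOn_thickTw h)

end Summit.ABC.ABC.Theorems.SharpModerateLaw.CuspDispersion

end
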